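import Literature.AlgebraicTopology.SingularHomology.MayerVietorisIsoRight
import Literature.Geometry.ComplexAnalytic.PhamBrieskornA3TwoBallDatum
import Mathlib.LinearAlgebra.Eigenspace.Basic
import HarnessLib

/-!
# Mayer–Vietoris with homologically trivial overlap: `Hₙ₊₁(U) ⊕ Hₙ₊₁(V) ≅ Hₙ₊₁(X)`, and the `s_*² = −1` part of `Hₙ₊₁(X)` when `s_*² = +1` on `V`

Topic `Literature/AlgebraicTopology/SingularHomology`; theorems only (no definition, no named fact). Written by the prover seat
`hodge-nonav-prover-Ax` (g18) for crux K1Q, stub S5 (`Summits/HodgeConjecture/HodgeConjecture/Theses/Q8SymplecticPowers.lean`): the local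
hypotheses of `Summit…Q8MonodromyBireflectionLocalConfiguration.monodromyBireflection_of_localConfiguration` live on the `τ|² = −1` part of
`H₂` of a ball piece `A = X_s(ℂ) ∩ Ball` of the member, which is covered by `U = A ∖ (E₊ ∪ E₋)` (a piece modelled on the free quotient
`F°∕ι` of the punctured `A₃` Milnor fibre, where `τ² = −1` on `H₂`) and a neighbourhood `V` of the two exceptional curves (where `τ² = +1`
on `H₂`), with `U ∩ V` two punctured disc bundles (rational homology of `ℝP³`: `H₁ = H₂ = 0`). Hatcher, *Algebraic Topology* §2.2 p. 149:

* `mayerVietoris.isIso_ψ_of_isZero` — `Hₙ₊₁(U ∩ V) = Hₙ(U ∩ V) = 0 ⇒ ψ : Hₙ₊₁(U) ⊞ Hₙ₊₁(V) ⟶ Hₙ₊₁(X)` is an isomorphism; element forms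
  `exists_eq_add_of_isZero` (surjectivity) and `eq_of_add_eq_add_of_isZero` (injectivity).
* **`kernelPart_of_mayerVietoris`** (`ℚ`-coefficients) — if a self-map `s` preserves `U`, `V` with `(s|U)_*² = −1` on `Hₙ₊₁(U)` and
  `(s|V)_*² = +1` on `Hₙ₊₁(V)`, then `ker(s_*² + 1) = im Hₙ₊₁(U)`, `im Hₙ₊₁(U) → Hₙ₊₁(X)` is injective, so
  `dim ker(s_*² + 1) = dim Hₙ₊₁(U)`; and a second self-map `g` preserving `U` with `(g|U)_* = (s|U)_*` (resp. `(g|U)_* (s|U)_* = 1`)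
  satisfies `g_* = s_*` (resp. `g_* s_* = 1`) on `ker(s_*² + 1)` (`map_eq_on_kernelPart`, `map_map_eq_on_kernelPart`).

## References

* [HatcherAT2002] A. Hatcher, Algebraic Topology, CUP 2002, §2.2 p. 149 (Mayer–Vietoris), §2.1 (naturality).
-/

noncomputable section

open CategoryTheory Limits Set ContinuousMap

universe u v

namespace Literature.AlgebraicTopology.SingularHomology

section Iso

variable (R : Type v) [CommRing R] (M : Type v) [AddCommGroup M] [Module R M] {X : Type u} [TopologicalSpace X]

/-- **`ψ : Hₙ₊₁(U) ⊞ Hₙ₊₁(V) ⟶ Hₙ₊₁(X)` is an isomorphism when `Hₙ₊₁(U ∩ V) = Hₙ(U ∩ V) = 0`** (`φₙ₊₁ = 0` gives `ψ` into, `δₙ = 0` gives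
`ψ` onto). [cite: HatcherAT2002, §2.2 p. 149] -/
theorem mayerVietoris.isIso_ψ_of_isZero (U V : Set X) (hUV : interior U ∪ interior V = univ) (n : ℕ)
    (hI₁ : IsZero (singularHomology R M ↥(U ∩ V) (n + 1))) (hI₀ : IsZero (singularHomology R M ↥(U ∩ V) n)) :
    IsIso (mayerVietoris.ψ R M U V (n + 1)) := by
  have hexc := relativeSingularHomology.isIso_map_of_interior_union_interior_holds R M X
  have hδ : mayerVietoris.δ R M U V hexc hUV n = 0 := hI₀.eq_of_tgt _ _
  haveI hepi : Epi (mayerVietoris.ψ R M U V (n + 1)) := (mayerVietoris.exact₂_holds R M U V hexc hUV n).epi_f hδ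
  have hφ0 : mayerVietoris.φ R M U V (n + 1) = 0 := hI₁.eq_of_src _ _
  haveI hmono : Mono (mayerVietoris.ψ R M U V (n + 1)) := (mayerVietoris.exact₁_holds R M U V hUV (n + 1)).mono_g hφ0
  exact isIso_of_mono_of_epi _

/-- `ψ (inl a + inr b) = i_U* a + i_V* b`. [cite: HatcherAT2002, §2.2 p. 149] -/
theorem mayerVietoris.ψ_inl_add_inr (U V : Set X) (n : ℕ) (a : singularHomology R M U n) (b : singularHomology R M V n) :
    mayerVietoris.ψ R M U V n ((biprod.inl : singularHomology R M U n ⟶ _) a + (biprod.inr : singularHomology R M V n ⟶ _) b) =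
      singularHomology.map R M (subsetIncl U) n a + singularHomology.map R M (subsetIncl V) n b := by
  rw [map_add, mayerVietoris.ψ, biprod_desc_inl_apply, biprod_desc_inr_apply]

/-- **Surjectivity**: with `Hₙ₊₁(U ∩ V) = Hₙ(U ∩ V) = 0`, every class of `Hₙ₊₁(X)` is `i_U* a + i_V* b`. [cite: HatcherAT2002, §2.2 p. 149] -/
theorem exists_eq_add_of_isZero (U V : Set X) (hUV : interior U ∪ interior V = univ) (n : ℕ)
    (hI₁ : IsZero (singularHomology R M ↥(U ∩ V) (n + 1))) (hI₀ : IsZero (singularHomology R M ↥(U ∩ V) n))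
    (x : singularHomology R M X (n + 1)) :
    ∃ (a : singularHomology R M U (n + 1)) (b : singularHomology R M V (n + 1)),
      x = singularHomology.map R M (subsetIncl U) (n + 1) a + singularHomology.map R M (subsetIncl V) (n + 1) b := by
  haveI := mayerVietoris.isIso_ψ_of_isZero R M U V hUV n hI₁ hI₀
  obtain ⟨y, rfl⟩ := ((forget (ModuleCat R)).mapIso (asIso (mayerVietoris.ψ R M U V (n + 1)))).toEquiv.surjective x
  refine ⟨(biprod.fst : _ ⟶ singularHomology R M U (n + 1)) y, (biprod.snd : _ ⟶ singularHomology R M V (n + 1)) y, ?_⟩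
  change mayerVietoris.ψ R M U V (n + 1) y = _
  rw [mayerVietoris.ψ, biprod_desc_apply]

/-- **Injectivity**: with `Hₙ₊₁(U ∩ V) = Hₙ(U ∩ V) = 0`, `i_U* a + i_V* b = i_U* a' + i_V* b'` forces `a = a'`, `b = b'`.
[cite: HatcherAT2002, §2.2 p. 149] -/
theorem eq_of_add_eq_add_of_isZero (U V : Set X) (hUV : interior U ∪ interior V = univ) (n : ℕ)
    (hI₁ : IsZero (singularHomology R M ↥(U ∩ V) (n + 1))) (hI₀ : IsZero (singularHomology R M ↥(U ∩ V) n))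
    {a a' : singularHomology R M U (n + 1)} {b b' : singularHomology R M V (n + 1)}
    (h : singularHomology.map R M (subsetIncl U) (n + 1) a + singularHomology.map R M (subsetIncl V) (n + 1) b =
      singularHomology.map R M (subsetIncl U) (n + 1) a' + singularHomology.map R M (subsetIncl V) (n + 1) b') :
    a = a' ∧ b = b' := by
  haveI := mayerVietoris.isIso_ψ_of_isZero R M U V hUV n hI₁ hI₀
  have hinj := ((forget (ModuleCat R)).mapIso (asIso (mayerVietoris.ψ R M U V (n + 1)))).toEquiv.injective
  have hy : (biprod.inl : singularHomology R M U (n + 1) ⟶ _) a + (biprod.inr : singularHomology R M V (n + 1) ⟶ _) b =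
      (biprod.inl : singularHomology R M U (n + 1) ⟶ _) a' + (biprod.inr : singularHomology R M V (n + 1) ⟶ _) b' := by
    apply hinj
    change mayerVietoris.ψ R M U V (n + 1) _ = mayerVietoris.ψ R M U V (n + 1) _
    rw [mayerVietoris.ψ_inl_add_inr, mayerVietoris.ψ_inl_add_inr, h]
  have hfst : ∀ (a₀ : singularHomology R M U (n + 1)) (b₀ : singularHomology R M V (n + 1)),
      (biprod.fst : singularHomology R M U (n + 1) ⊞ singularHomology R M V (n + 1) ⟶ _)
        ((biprod.inl : singularHomology R M U (n + 1) ⟶ _) a₀ + (biprod.inr : singularHomology R M V (n + 1) ⟶ _) b₀) = a₀ :=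
    fun a₀ b₀ => by
      rw [map_add, ← ModuleCat.comp_apply, ← ModuleCat.comp_apply, biprod.inl_fst, biprod.inr_fst, ModuleCat.id_apply]
      change a₀ + (0 : singularHomology R M V (n + 1) ⟶ singularHomology R M U (n + 1)).hom b₀ = a₀
      rw [ModuleCat.hom_zero, LinearMap.zero_apply, add_zero]
  have hsnd : ∀ (a₀ : singularHomology R M U (n + 1)) (b₀ : singularHomology R M V (n + 1)),
      (biprod.snd : singularHomology R M U (n + 1) ⊞ singularHomology R M V (n + 1) ⟶ _)
        ((biprod.inl : singularHomology R M U (n + 1) ⟶ _) a₀ + (biprod.inr : singularHomology R M V (n + 1) ⟶ _) b₀) = b₀ :=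
    fun a₀ b₀ => by
      rw [map_add, ← ModuleCat.comp_apply, ← ModuleCat.comp_apply, biprod.inl_snd, biprod.inr_snd, ModuleCat.id_apply]
      change (0 : singularHomology R M U (n + 1) ⟶ singularHomology R M V (n + 1)).hom a₀ + b₀ = b₀
      rw [ModuleCat.hom_zero, LinearMap.zero_apply, zero_add]
  constructor
  · have h1 := congrArg (biprod.fst : singularHomology R M U (n + 1) ⊞ singularHomology R M V (n + 1) ⟶ _) hy
    rwa [hfst, hfst] at h1
  · have h2 := congrArg (biprod.snd : singularHomology R M U (n + 1) ⊞ singularHomology R M V (n + 1) ⟶ _) hy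
    rwa [hsnd, hsnd] at h2

end Iso

/-! ### The `s_*² = −1` part -/

section KernelPart

variable {A : Type} [TopologicalSpace A]

/-- **The `s_*² = −1` part of `Hₙ₊₁(A; ℚ)` under a Mayer–Vietoris splitting.** `A = U ∪ V` open with `Hₙ₊₁(U ∩ V) = Hₙ(U ∩ V) = 0`; a
self-map `s` preserving `U` and `V` with `(s|U)_*² = −1` on `Hₙ₊₁(U)` and `(s|V)_*² = +1` on `Hₙ₊₁(V)`. Then every `x` with `s_*² x = −x`
is `i_U* a` (with `(s|U)_*`-data `a`), `i_U*` is injective, and `s_*² = −1` on `im i_U*`. [cite: HatcherAT2002, §2.2 p. 149 and §2.1] -/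
theorem kernelPart_of_mayerVietoris {U V : Set A} (hUo : IsOpen U) (hVo : IsOpen V) (hUV : U ∪ V = univ) (n : ℕ)
    (hI₁ : IsZero (singularHomology ℚ ℚ ↥(U ∩ V) (n + 1))) (hI₀ : IsZero (singularHomology ℚ ℚ ↥(U ∩ V) n))
    (s : C(A, A)) (hsU : MapsTo s U U) (hsV : MapsTo s V V)
    (hsU2 : ∀ u : singularHomology ℚ ℚ U (n + 1), singularHomology.map ℚ ℚ (singularHomology.restrictSelf s hsU) (n + 1)
      (singularHomology.map ℚ ℚ (singularHomology.restrictSelf s hsU) (n + 1) u) = -u)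
    (hsV2 : ∀ v : singularHomology ℚ ℚ V (n + 1), singularHomology.map ℚ ℚ (singularHomology.restrictSelf s hsV) (n + 1)
      (singularHomology.map ℚ ℚ (singularHomology.restrictSelf s hsV) (n + 1) v) = v) :
    (∀ x : singularHomology ℚ ℚ A (n + 1), singularHomology.map ℚ ℚ s (n + 1) (singularHomology.map ℚ ℚ s (n + 1) x) = -x →
      ∃ a : singularHomology ℚ ℚ U (n + 1), x = singularHomology.map ℚ ℚ (subsetIncl U) (n + 1) a) ∧
    Function.Injective (singularHomology.map ℚ ℚ (subsetIncl U) (n + 1)) ∧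
    (∀ a : singularHomology ℚ ℚ U (n + 1), singularHomology.map ℚ ℚ s (n + 1) (singularHomology.map ℚ ℚ s (n + 1)
      (singularHomology.map ℚ ℚ (subsetIncl U) (n + 1) a)) = -singularHomology.map ℚ ℚ (subsetIncl U) (n + 1) a) := by
  have hUV' : interior U ∪ interior V = univ := by rw [hUo.interior_eq, hVo.interior_eq, hUV]
  -- naturality on each piece
  have hnatU : ∀ a : singularHomology ℚ ℚ U (n + 1), singularHomology.map ℚ ℚ s (n + 1) (singularHomology.map ℚ ℚ (subsetIncl U) (n + 1) a) =
      singularHomology.map ℚ ℚ (subsetIncl U) (n + 1) (singularHomology.map ℚ ℚ (singularHomology.restrictSelf s hsU) (n + 1) a) :=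
    fun a => singularHomology.map_map_subsetIncl_of_mapsTo ℚ s hsU (n + 1) a
  have hnatV : ∀ b : singularHomology ℚ ℚ V (n + 1), singularHomology.map ℚ ℚ s (n + 1) (singularHomology.map ℚ ℚ (subsetIncl V) (n + 1) b) =
      singularHomology.map ℚ ℚ (subsetIncl V) (n + 1) (singularHomology.map ℚ ℚ (singularHomology.restrictSelf s hsV) (n + 1) b) :=
    fun b => singularHomology.map_map_subsetIncl_of_mapsTo ℚ s hsV (n + 1) b
  have hthird : ∀ a : singularHomology ℚ ℚ U (n + 1), singularHomology.map ℚ ℚ s (n + 1) (singularHomology.map ℚ ℚ s (n + 1)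
      (singularHomology.map ℚ ℚ (subsetIncl U) (n + 1) a)) = -singularHomology.map ℚ ℚ (subsetIncl U) (n + 1) a := fun a => by
    rw [hnatU, hnatU, hsU2, map_neg]
  refine ⟨fun x hx => ?_, fun a a' h => ?_, hthird⟩
  · obtain ⟨a, b, rfl⟩ := exists_eq_add_of_isZero ℚ ℚ U V hUV' n hI₁ hI₀ x
    -- apply `s_*²`: `−(i a + i b) = i (−a) + i b`, so `b = −b`, `b = 0`
    rw [map_add, map_add, hnatU, hnatU, hsU2, hnatV, hnatV, hsV2, map_neg, neg_add, ← map_neg, ← map_neg] at hx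
    obtain ⟨-, hb⟩ := eq_of_add_eq_add_of_isZero ℚ ℚ U V hUV' n hI₁ hI₀ hx
    have hb0 : b = 0 := by
      have h2 : (2 : ℚ) • b = 0 := by rw [two_smul]; nth_rewrite 1 [hb]; exact neg_add_cancel b
      exact (smul_eq_zero.mp h2).resolve_left (by norm_num)
    exact ⟨a, by rw [hb0, map_zero, add_zero]⟩
  · have h' : singularHomology.map ℚ ℚ (subsetIncl U) (n + 1) a + singularHomology.map ℚ ℚ (subsetIncl V) (n + 1) 0 =
        singularHomology.map ℚ ℚ (subsetIncl U) (n + 1) a' + singularHomology.map ℚ ℚ (subsetIncl V) (n + 1) 0 := by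
      rw [map_zero, add_zero, add_zero]; exact h
    exact (eq_of_add_eq_add_of_isZero ℚ ℚ U V hUV' n hI₁ hI₀ h').1

/-- **Rank of the `s_*² = −1` part**: `dim ker(s_*² + 1) = dim Hₙ₊₁(U; ℚ)` under the hypotheses of `kernelPart_of_mayerVietoris`.
[cite: HatcherAT2002, §2.2 p. 149] -/
theorem finrank_kernelPart_of_mayerVietoris {U V : Set A} (hUo : IsOpen U) (hVo : IsOpen V) (hUV : U ∪ V = univ) (n : ℕ)
    (hI₁ : IsZero (singularHomology ℚ ℚ ↥(U ∩ V) (n + 1))) (hI₀ : IsZero (singularHomology ℚ ℚ ↥(U ∩ V) n))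
    (s : C(A, A)) (hsU : MapsTo s U U) (hsV : MapsTo s V V)
    (hsU2 : ∀ u : singularHomology ℚ ℚ U (n + 1), singularHomology.map ℚ ℚ (singularHomology.restrictSelf s hsU) (n + 1)
      (singularHomology.map ℚ ℚ (singularHomology.restrictSelf s hsU) (n + 1) u) = -u)
    (hsV2 : ∀ v : singularHomology ℚ ℚ V (n + 1), singularHomology.map ℚ ℚ (singularHomology.restrictSelf s hsV) (n + 1)
      (singularHomology.map ℚ ℚ (singularHomology.restrictSelf s hsV) (n + 1) v) = v)
    [Module.Finite ℚ (singularHomology ℚ ℚ U (n + 1))] :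
    Module.finrank ℚ ↥(Module.End.eigenspace ((singularHomology.map ℚ ℚ s (n + 1)).hom ^ 2) (-1 : ℚ)) =
      Module.finrank ℚ (singularHomology ℚ ℚ U (n + 1)) := by
  obtain ⟨hker, hinj, hsq⟩ := kernelPart_of_mayerVietoris hUo hVo hUV n hI₁ hI₀ s hsU hsV hsU2 hsV2
  have hE : Module.End.eigenspace ((singularHomology.map ℚ ℚ s (n + 1)).hom ^ 2) (-1 : ℚ) =
      LinearMap.range (singularHomology.map ℚ ℚ (subsetIncl U) (n + 1)).hom := by
    ext x
    rw [Module.End.mem_eigenspace_iff, pow_two, Module.End.mul_apply, neg_one_smul, LinearMap.mem_range]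
    constructor
    · intro hx
      obtain ⟨a, rfl⟩ := hker x hx
      exact ⟨a, rfl⟩
    · rintro ⟨a, rfl⟩
      exact hsq a
  rw [hE]
  exact LinearMap.finrank_range_of_inj hinj

/-- **Transfer of `(g|U)_* = (s|U)_*` to the `s_*² = −1` part**: `g_* x = s_* x` for `s_*² x = −x`. [cite: HatcherAT2002, §2.1] -/
theorem map_eq_on_kernelPart {U V : Set A} (hUo : IsOpen U) (hVo : IsOpen V) (hUV : U ∪ V = univ) (n : ℕ)
    (hI₁ : IsZero (singularHomology ℚ ℚ ↥(U ∩ V) (n + 1))) (hI₀ : IsZero (singularHomology ℚ ℚ ↥(U ∩ V) n))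
    (s g : C(A, A)) (hsU : MapsTo s U U) (hsV : MapsTo s V V) (hgU : MapsTo g U U)
    (hsU2 : ∀ u : singularHomology ℚ ℚ U (n + 1), singularHomology.map ℚ ℚ (singularHomology.restrictSelf s hsU) (n + 1)
      (singularHomology.map ℚ ℚ (singularHomology.restrictSelf s hsU) (n + 1) u) = -u)
    (hsV2 : ∀ v : singularHomology ℚ ℚ V (n + 1), singularHomology.map ℚ ℚ (singularHomology.restrictSelf s hsV) (n + 1)
      (singularHomology.map ℚ ℚ (singularHomology.restrictSelf s hsV) (n + 1) v) = v)
    (hgs : ∀ u : singularHomology ℚ ℚ U (n + 1), singularHomology.map ℚ ℚ (singularHomology.restrictSelf g hgU) (n + 1) u =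
      singularHomology.map ℚ ℚ (singularHomology.restrictSelf s hsU) (n + 1) u)
    (x : singularHomology ℚ ℚ A (n + 1)) (hx : singularHomology.map ℚ ℚ s (n + 1) (singularHomology.map ℚ ℚ s (n + 1) x) = -x) :
    singularHomology.map ℚ ℚ g (n + 1) x = singularHomology.map ℚ ℚ s (n + 1) x := by
  obtain ⟨hker, -, -⟩ := kernelPart_of_mayerVietoris hUo hVo hUV n hI₁ hI₀ s hsU hsV hsU2 hsV2
  obtain ⟨a, rfl⟩ := hker x hx
  rw [singularHomology.map_map_subsetIncl_of_mapsTo ℚ g hgU (n + 1), singularHomology.map_map_subsetIncl_of_mapsTo ℚ s hsU (n + 1)]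
  exact congrArg _ (hgs a)

/-- **Transfer of `(g|U)_* (s|U)_* = 1` to the `s_*² = −1` part**: `g_* (s_* x) = x` for `s_*² x = −x`. [cite: HatcherAT2002, §2.1] -/
theorem map_map_eq_on_kernelPart {U V : Set A} (hUo : IsOpen U) (hVo : IsOpen V) (hUV : U ∪ V = univ) (n : ℕ)
    (hI₁ : IsZero (singularHomology ℚ ℚ ↥(U ∩ V) (n + 1))) (hI₀ : IsZero (singularHomology ℚ ℚ ↥(U ∩ V) n))
    (s g : C(A, A)) (hsU : MapsTo s U U) (hsV : MapsTo s V V) (hgU : MapsTo g U U)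
    (hsU2 : ∀ u : singularHomology ℚ ℚ U (n + 1), singularHomology.map ℚ ℚ (singularHomology.restrictSelf s hsU) (n + 1)
      (singularHomology.map ℚ ℚ (singularHomology.restrictSelf s hsU) (n + 1) u) = -u)
    (hsV2 : ∀ v : singularHomology ℚ ℚ V (n + 1), singularHomology.map ℚ ℚ (singularHomology.restrictSelf s hsV) (n + 1)
      (singularHomology.map ℚ ℚ (singularHomology.restrictSelf s hsV) (n + 1) v) = v)
    (hgs : ∀ u : singularHomology ℚ ℚ U (n + 1), singularHomology.map ℚ ℚ (singularHomology.restrictSelf g hgU) (n + 1)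
      (singularHomology.map ℚ ℚ (singularHomology.restrictSelf s hsU) (n + 1) u) = u)
    (x : singularHomology ℚ ℚ A (n + 1)) (hx : singularHomology.map ℚ ℚ s (n + 1) (singularHomology.map ℚ ℚ s (n + 1) x) = -x) :
    singularHomology.map ℚ ℚ g (n + 1) (singularHomology.map ℚ ℚ s (n + 1) x) = x := by
  obtain ⟨hker, -, -⟩ := kernelPart_of_mayerVietoris hUo hVo hUV n hI₁ hI₀ s hsU hsV hsU2 hsV2
  obtain ⟨a, rfl⟩ := hker x hx
  rw [singularHomology.map_map_subsetIncl_of_mapsTo ℚ s hsU (n + 1), singularHomology.map_map_subsetIncl_of_mapsTo ℚ g hgU (n + 1)]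
  exact congrArg _ (hgs a)

end KernelPart

end Literature.AlgebraicTopology.SingularHomology

end
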